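import Literature.Analysis.FluidPDE.TaoUnitViscosity
import HarnessLib

/-!
# Tao (2011/2013), Thm. 10.1 for annuli (Remark 10.6) and the proved passage to the exterior
# region by monotone convergence

Fifth layer of the decomposition of Tao 2011, Cor. 11.4 (`NS.tao_unconditional_uniqueness`)
along its printed proof. After `TaoUnitViscosity.lean` the `A`-side leaf of the Cor. 11.1 chain
is `NS.tao2011_enstrophyLocalisation_exterior_apriori_unit`: the conclusion of the §10 argument
(arXiv:1108.1165, pp. 30–33, `ν = 1`) in the *exterior-region* form of **Remark 10.6** (arXiv
Rem. 64, p. 33), with the two global inputs (Prop. 9.1, Lemma 8.1) as hypotheses. Remark 10.6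
obtains the exterior form in two printed steps:

1. "we may adapt the proof of Theorem 10.1 to an annulus, replacing the ball `B(x₀,R)` with an
   annulus `B(x₀,R') \ B(x₀,R)` for some `0 < R < R'` with `0 < r < R/2, (R'-R)/2`, and replacing
   the smaller ball `B(x₀,R-r)` with the smaller annulus `B(x₀,R'-r) \ B(x₀,R+r)` […] the proof
   method is essentially identical and is omitted" — vendored here as the named fact
   `NS.tao2011_enstrophyLocalisation_annulus_apriori_unit` (same a priori inputs, same
   dictionary as the exterior leaf);
2. "Sending `R'` to infinity and using the monotone convergence theorem, we may in fact replace
   the annulus `B(x₀,R') \ B(x₀,R)` with the exterior region `ℝ³ \ B(x₀,R)`, and the annulus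
   `B(x₀,R'-r) \ B(x₀,R+r)` with `ℝ³ \ B(x₀,R+r)`" — **proved** here:
   `NS.tao2011_enstrophyLocalisation_exterior_apriori_unit_of_annulus`. The initial hypothesis
   on each annulus `B(x₀,R'ₙ) \ B(x₀,R)`, `R'ₙ = R + 2r + n + 1`, follows from the exterior one by
   monotonicity of the integral; the conclusions hold on the annuli
   `Sₙ = B(x₀,R+r+n+1) \ B(x₀,R+r)` with constants independent of `n`, `⋃ₙ Sₙ = ℝ³ \ B(x₀,R+r)`,
   and monotone convergence is Mathlib's `setLIntegral_iUnion_of_directed` (in `x`, for each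
   `t`) and `lintegral_iSup'` (in `t`, for the space-time bound on `∇ω`); the latter needs the
   a.e.-measurability of `t ↦ ∫_{Sₙ} |∇ω(t)|²` on `(0, T)`, which we get from the joint continuity
   of `(t, x) ↦ ∇ω(t, x)` on the closed slab (`continuousOn_fderiv_curl_slab`) after clamping the
   time variable to `[0, T]` (`aemeasurable_setLIntegral_fderiv_curl`).

Consequently the leaf may now be taken to be the annulus statement
(`NS.tao_unconditional_uniqueness_of_annulus_leaves`).

## Mathlib / tree search

`lean search 'annulus|Annulus'` (FluidPDE): only docstring mentions; no annular form of
Thm. 10.1 in the tree. Mathlib: `MeasureTheory.setLIntegral_iUnion_of_directed` (monotone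
convergence for set integrals, no measurability needed), `MeasureTheory.lintegral_iSup'`,
`Measurable.lintegral_prod_right'`, `measurable_fderiv`; tree: `Fluid.fderiv_curl`,
`Fluid.IsSmoothSpaceTimeOn.fderiv_slice` (`TaoEnstrophyLocalisation.lean`).

## References

* T. Tao, *Localisation and compactness properties of the Navier–Stokes global regularity
  problem*, Anal. PDE 6 (2013) 25–107 = arXiv:1108.1165 (`Tao2011`): Thm. 10.1 and its proof
  (arXiv Thm. 59, §10, pp. 30–33), Remark 10.6 (arXiv Rem. 64, p. 33), Cor. 11.1 (arXiv Cor. 68),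
  Cor. 11.4 (arXiv Cor. 71).
-/

noncomputable section

open MeasureTheory Set Function Filter Topology
open scoped ENNReal NNReal ContDiff

namespace Literature.Analysis.FluidPDE

/-- Local notation for physical space `ℝ³ = EuclideanSpace ℝ (Fin 3)`. -/
local notation "ℝ³" => EuclideanSpace ℝ (Fin 3)

/-! ## Thm. 10.1 for annuli (Remark 10.6), a priori form, unit viscosity -/

/-- **Tao 2011, Thm. 10.1 (Enstrophy localisation) for annuli, Remark 10.6, a priori form, unit
viscosity.** Printed (arXiv Rem. 64, p. 33): "we may adapt the proof of Theorem 10.1 to an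
annulus, replacing the ball `B(x₀,R)` with an annulus `B(x₀,R') \ B(x₀,R)` for some `0 < R < R'`
with `0 < r < R/2, (R'-R)/2`, and replacing the smaller ball `B(x₀,R-r)` with the smaller annulus
`B(x₀,R'-r) \ B(x₀,R+r)`"; i.e. (Thm. 10.1, arXiv Thm. 59, `ν = 1`, `f = 0`): if
`‖ω₀‖_{L²(B(x₀,R₂) \ B(x₀,R₁))} ≤ δ` (10.1), `δ⁴T + δ⁵E^{1/2}T ≤ c` (10.2) and `r` is large
(10.3), then `‖ω‖_{L^∞_t L²_x}` and `‖∇ω‖_{L²_t L²_x}` on `[0,T] × (B(x₀,R₂-r) \ B(x₀,R₁+r))` are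
`≲ δ`. As for the exterior leaf `tao2011_enstrophyLocalisation_exterior_apriori_unit` (same
dictionary: classical solution on the closed slab `[0,T] × ℝ³`, `ω = Fluid.curl`, `|∇ω|` the
operator norm of `D(curl u)`, `L^∞_t` pointwise in `t ∈ [0,T]`, the two summands bounded
separately by `Aδ`), the two global inputs of the §10 argument are made hypotheses — Lemma 8.1 as
`sup_t ∫|u(t)|² ≤ 2E`, `∫₀ᵀ∫|∇u|² ≤ E`, and Prop. 9.1 as `∫₀ᵀ ‖u(t)‖_{L^∞} dt ≤ M` — and (10.3) is
read in the form the proof uses it, `r > C(E + M + δ⁻²)`. The printed proof for the ball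
(pp. 30–33) is asserted to adapt with "a slightly more complicated cutoff (which is shrinking
inside the annulus […] towards the smaller annulus)"; it is not reproduced here. The exterior
form follows by monotone convergence (`tao2011_enstrophyLocalisation_exterior_apriori_unit_of_annulus`,
PROVED). [cite: Tao2011, Thm. 10.1 + Remark 10.6] -/
def tao2011_enstrophyLocalisation_annulus_apriori_unit : Prop :=
  ∃ c C A : ℝ, 0 < c ∧ 0 < C ∧ 0 < A ∧
    ∀ ⦃T : ℝ⦄ (_hT : 0 < T) ⦃u : ℝ → ℝ³ → ℝ³⦄ ⦃p : ℝ → ℝ³ → ℝ⦄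
      (_hsol : FluidPDE.IsClassicalNSSolutionOn (Icc 0 T) 1 0 u p)
      ⦃E M : ℝ⦄ (_hE : 0 ≤ E) (_hM : 0 ≤ M)
      (_hEt : ∀ t ∈ Icc 0 T, ∫⁻ x, ‖u t x‖ₑ ^ 2 ≤ ENNReal.ofReal (2 * E))
      (_hD : ENNReal.ofReal 1 *
          ∫⁻ t in Ioo 0 T, ∫⁻ x, ENNReal.ofReal (FluidPDE.frobeniusNormSq (fderiv ℝ (u t) x)) ≤
        ENNReal.ofReal E)
      (_hMt : ∫⁻ t in Ioo 0 T, eLpNorm (u t) ∞ volume ≤ ENNReal.ofReal M)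
      (x₀ : ℝ³) ⦃R₁ R₂ r δ : ℝ⦄ (_hδ : 0 < δ) (_hr : 0 < r) (_hrR₁ : r < R₁ / 2)
      (_hrR₂ : r < (R₂ - R₁) / 2)
      (_hω₀ : ∫⁻ x in Metric.ball x₀ R₂ \ Metric.ball x₀ R₁, ‖FluidPDE.curl (u 0) x‖ₑ ^ 2 ≤
        ENNReal.ofReal (δ ^ 2))
      (_hsmall : δ ^ 4 * T + δ ^ 5 * Real.sqrt E * T ≤ c)
      (_hlarge : C * (E + M + δ⁻¹ ^ 2) < r),
      (∀ t ∈ Icc 0 T, ∫⁻ x in Metric.ball x₀ (R₂ - r) \ Metric.ball x₀ (R₁ + r),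
          ‖FluidPDE.curl (u t) x‖ₑ ^ 2 ≤ ENNReal.ofReal ((A * δ) ^ 2)) ∧
        ∫⁻ t in Ioo 0 T, ∫⁻ x in Metric.ball x₀ (R₂ - r) \ Metric.ball x₀ (R₁ + r),
            ‖fderiv ℝ (FluidPDE.curl (u t)) x‖ₑ ^ 2 ≤ ENNReal.ofReal ((A * δ) ^ 2)

/-! ## Measurability of the annular dissipation `t ↦ ∫_S |∇ω(t)|²` -/

/-- For a classical solution on the closed slab `[0, T] × ℝ³`, `T > 0`, the vorticity gradient
`(t, x) ↦ D(curl u(t))(x) = curlCLM ∘ D²u(t)(x)` is jointly continuous on the slab (the slice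
derivatives of a jointly smooth field are jointly smooth, twice). [folklore] -/
theorem continuousOn_fderiv_curl_slab {T ν : ℝ} (hT : 0 < T) {f u : ℝ → ℝ³ → ℝ³}
    {p : ℝ → ℝ³ → ℝ} (hsol : FluidPDE.IsClassicalNSSolutionOn (Icc 0 T) ν f u p) :
    ContinuousOn (fun z : ℝ × ℝ³ => fderiv ℝ (FluidPDE.curl (u z.1)) z.2) (Icc 0 T ×ˢ univ) := by
  have hU : UniqueDiffOn ℝ (Icc 0 T) := uniqueDiffOn_Icc hT
  have h2 : FluidPDE.IsSmoothSpaceTimeOn (Icc 0 T)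
      (fun t x => fderiv ℝ (fun y => fderiv ℝ (u t) y) x) :=
    (hsol.smooth_velocity.fderiv_slice hU).fderiv_slice hU
  have h3 : ContinuousOn (fun z : ℝ × ℝ³ =>
      FluidPDE.curlCLM.comp (fderiv ℝ (fun y => fderiv ℝ (u z.1) y) z.2)) (Icc 0 T ×ˢ univ) :=
    (ContinuousLinearMap.compL ℝ ℝ³ (ℝ³ →L[ℝ] ℝ³) ℝ³ FluidPDE.curlCLM).continuous.comp_continuousOn
      h2.continuousOn
  refine h3.congr ?_
  rintro ⟨t, x⟩ ⟨ht, -⟩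
  have h2t : ContDiff ℝ 2 (u t) := (hsol.contDiff_velocity ht).of_le (by norm_cast)
  exact FluidPDE.fderiv_curl h2t x

/-- For a classical solution on the closed slab `[0, T] × ℝ³` and any set `S ⊆ ℝ³`, the annular
dissipation `t ↦ ∫_S |∇ω(t)|²` is a.e.-measurable on `(0, T)`: clamping the time variable to
`[0, T]` gives a jointly continuous integrand on `ℝ × ℝ³`, whose partial integral is measurable
(Tonelli), and the two agree on `(0, T)`. [folklore] -/
theorem aemeasurable_setLIntegral_fderiv_curl {T ν : ℝ} (hT : 0 < T) {f u : ℝ → ℝ³ → ℝ³}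
    {p : ℝ → ℝ³ → ℝ} (hsol : FluidPDE.IsClassicalNSSolutionOn (Icc 0 T) ν f u p) (S : Set ℝ³) :
    AEMeasurable (fun t => ∫⁻ x in S, ‖fderiv ℝ (FluidPDE.curl (u t)) x‖ₑ ^ 2)
      (volume.restrict (Ioo 0 T)) := by
  have hGc := continuousOn_fderiv_curl_slab hT hsol
  -- clamp the time variable to `[0, T]`
  have hπc : Continuous fun t : ℝ => max 0 (min T t) :=
    continuous_const.max (continuous_const.min continuous_id)
  have hπmem : ∀ t : ℝ, max 0 (min T t) ∈ Icc 0 T := fun t =>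
    ⟨le_max_left _ _, max_le hT.le (min_le_left _ _)⟩
  have hπid : ∀ t ∈ Icc 0 T, max 0 (min T t) = t := fun t ht => by
    rw [min_eq_right ht.2, max_eq_right ht.1]
  have hHc : Continuous fun z : ℝ × ℝ³ => fderiv ℝ (FluidPDE.curl (u (max 0 (min T z.1)))) z.2 := by
    have hmap : Continuous fun z : ℝ × ℝ³ => ((max 0 (min T z.1), z.2) : ℝ × ℝ³) :=
      (hπc.comp continuous_fst).prodMk continuous_snd
    exact hGc.comp_continuous hmap fun z => mk_mem_prod (hπmem z.1) (mem_univ _)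
  have hmeas : Measurable fun z : ℝ × ℝ³ =>
      ‖fderiv ℝ (FluidPDE.curl (u (max 0 (min T z.1)))) z.2‖ₑ ^ 2 :=
    hHc.enorm.measurable.pow_const 2
  have hF : Measurable fun t : ℝ =>
      ∫⁻ x in S, ‖fderiv ℝ (FluidPDE.curl (u (max 0 (min T t)))) x‖ₑ ^ 2 :=
    hmeas.lintegral_prod_right'
  refine hF.aemeasurable.congr ?_
  refine (ae_restrict_mem measurableSet_Ioo).mono fun t ht => ?_
  simp only [hπid t (Ioo_subset_Icc_self ht)]

/-! ## Remark 10.6, second step: annulus ⇒ exterior region (monotone convergence) -/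

/-- **Tao 2011, Remark 10.6, "sending `R'` to infinity" (PROVED).** The annular a priori form of
Thm. 10.1 implies the exterior a priori form `tao2011_enstrophyLocalisation_exterior_apriori_unit`,
with the same constants: given the exterior hypothesis `‖ω₀‖_{L²(ℝ³ \ B(x₀,R))} ≤ δ`, each annulus
`B(x₀,R'ₙ) \ B(x₀,R)`, `R'ₙ = R + 2r + n + 1`, satisfies (10.1) by monotonicity, so the annular
theorem bounds `ω` and `∇ω` on `Sₙ = B(x₀,R+r+n+1) \ B(x₀,R+r)` uniformly in `n`; since
`⋃ₙ Sₙ = ℝ³ \ B(x₀,R+r)` increasingly, monotone convergence (in `x` for each `t`; then in `t`)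
gives the exterior bounds. [cite: Tao2011, Remark 10.6] -/
theorem tao2011_enstrophyLocalisation_exterior_apriori_unit_of_annulus
    (h : tao2011_enstrophyLocalisation_annulus_apriori_unit) :
    tao2011_enstrophyLocalisation_exterior_apriori_unit := by
  obtain ⟨c, C, A, hc, hC, hA, hmain⟩ := h
  refine ⟨c, C, A, hc, hC, hA, ?_⟩
  intro T hT u p hsol E M hE hM hEt hD hMt x₀ R r δ hδ hr hrR hω₀ hsmall hlarge
  -- the exhausting annuli `Sₙ = B(x₀, R + r + n + 1) \ B(x₀, R + r)`
  obtain ⟨S, hS⟩ : ∃ S : ℕ → Set ℝ³,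
      S = fun n : ℕ => Metric.ball x₀ (R + r + ((n : ℝ) + 1)) \ Metric.ball x₀ (R + r) :=
    ⟨_, rfl⟩
  have hSmono : Monotone S := by
    intro m n hmn x hx
    rw [hS] at hx ⊢
    refine ⟨?_, hx.2⟩
    have hmn' : (m : ℝ) ≤ n := by exact_mod_cast hmn
    exact Metric.ball_subset_ball (by linarith) hx.1
  have hSdir : Directed (· ⊆ ·) S := fun m n =>
    ⟨max m n, hSmono (le_max_left m n), hSmono (le_max_right m n)⟩
  have hSU : (⋃ n, S n) = (Metric.ball x₀ (R + r))ᶜ := by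
    ext x
    simp only [hS, mem_iUnion, Set.mem_sdiff, Metric.mem_ball, mem_compl_iff]
    constructor
    · rintro ⟨n, -, hx⟩
      exact hx
    · intro hx
      obtain ⟨n, hn⟩ := exists_nat_gt (dist x x₀ - (R + r))
      refine ⟨n, ?_, hx⟩
      linarith
  -- the annular theorem on `B(x₀, R + 2r + n + 1) \ B(x₀, R)`
  have hball : ∀ n : ℕ,
      (∀ t ∈ Icc 0 T, ∫⁻ x in S n, ‖FluidPDE.curl (u t) x‖ₑ ^ 2 ≤ ENNReal.ofReal ((A * δ) ^ 2)) ∧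
        ∫⁻ t in Ioo 0 T, ∫⁻ x in S n, ‖fderiv ℝ (FluidPDE.curl (u t)) x‖ₑ ^ 2 ≤
          ENNReal.ofReal ((A * δ) ^ 2) := by
    intro n
    have hn0 : (0 : ℝ) ≤ n := n.cast_nonneg
    have hrR₂ : r < (R + 2 * r + (n + 1) - R) / 2 := by linarith
    have hω₀' : ∫⁻ x in Metric.ball x₀ (R + 2 * r + (n + 1)) \ Metric.ball x₀ R,
        ‖FluidPDE.curl (u 0) x‖ₑ ^ 2 ≤ ENNReal.ofReal (δ ^ 2) :=
      (lintegral_mono_set fun x hx => hx.2).trans hω₀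
    have key := hmain hT hsol hE hM hEt hD hMt x₀ hδ hr hrR hrR₂ hω₀' hsmall hlarge
    have e : R + 2 * r + ((n : ℝ) + 1) - r = R + r + (n + 1) := by ring
    rw [e] at key
    rw [hS]
    exact key
  refine ⟨fun t ht => ?_, ?_⟩
  · -- monotone convergence in `x`
    rw [← hSU, setLIntegral_iUnion_of_directed _ hSdir]
    exact iSup_le fun n => (hball n).1 t ht
  · -- monotone convergence in `x` for each `t`, then in `t`
    have hF : ∀ t, ∫⁻ x in (Metric.ball x₀ (R + r))ᶜ, ‖fderiv ℝ (FluidPDE.curl (u t)) x‖ₑ ^ 2 =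
        ⨆ n, ∫⁻ x in S n, ‖fderiv ℝ (FluidPDE.curl (u t)) x‖ₑ ^ 2 := fun t => by
      rw [← hSU, setLIntegral_iUnion_of_directed _ hSdir]
    simp_rw [hF]
    rw [lintegral_iSup' (fun n => aemeasurable_setLIntegral_fderiv_curl hT hsol (S n))
      (ae_of_all _ fun t m n hmn => lintegral_mono_set (hSmono hmn))]
    exact iSup_le fun n => (hball n).2

/-! ## The leaf structure of Cor. 11.1 and Cor. 11.4 after this file -/

/-- **Thm. 10.1 (exterior form, `ν > 0`, a priori) from the annular unit-viscosity statement**: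
monotone convergence (this file) followed by the viscosity rescaling of `TaoUnitViscosity.lean`. [cite: Tao2011, Thm. 10.1 + Remark 10.6] -/
theorem tao2011_enstrophyLocalisation_exterior_apriori_of_annulus_unit
    (h : tao2011_enstrophyLocalisation_annulus_apriori_unit) :
    tao2011_enstrophyLocalisation_exterior_apriori :=
  tao2011_enstrophyLocalisation_exterior_apriori_of_unit
    (tao2011_enstrophyLocalisation_exterior_apriori_unit_of_annulus h)

/-- **Cor. 11.1 (bounded enstrophy, every `ν > 0`) from unit-viscosity leaves, annular form of
the §10 leaf**: Lemma 8.1 (`tao_finite_energy_smooth_energy_bound`), Prop. 9.1 at `ν = 1`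
(`tao2011_boundedTotalSpeed_unit`) and Thm. 10.1 for annuli at `ν = 1`
(`tao2011_enstrophyLocalisation_annulus_apriori_unit`); everything else (monotone convergence to
the exterior region, rescaling, the Fourier step, the assembly of Cor. 11.1) is proved. [cite: Tao2011, Cor. 11.1] -/
theorem tao2011_boundedEnstrophy_of_annulus_leaves (hL : tao_finite_energy_smooth_energy_bound)
    (hP : tao2011_boundedTotalSpeed_unit)
    (hA : tao2011_enstrophyLocalisation_annulus_apriori_unit) : tao2011_boundedEnstrophy :=
  tao2011_boundedEnstrophy_of_unit_leaves hL hP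
    (tao2011_enstrophyLocalisation_exterior_apriori_unit_of_annulus hA)

/-- **Cor. 11.4 (`tao_unconditional_uniqueness`, every `ν > 0`) from unit-viscosity leaves,
annular form of the §10 leaf**: Lemma 8.1, Prop. 9.1 at `ν = 1` and Thm. 10.1 for annuli at
`ν = 1` (a priori form); the `B`-side composite Cor. 4.3 + Thm. 5.4 (iii) is the tree theorem
`tao2011_velocity_eq_of_memSobolevX_holds` (fed in by `tao_unconditional_uniqueness_of_unit_leaves`). [cite: Tao2011, Cor. 11.4] -/
theorem tao_unconditional_uniqueness_of_annulus_leaves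
    (hL : tao_finite_energy_smooth_energy_bound) (hP : tao2011_boundedTotalSpeed_unit)
    (hA : tao2011_enstrophyLocalisation_annulus_apriori_unit) :
    tao_unconditional_uniqueness ∧ tao_unconditional_uniqueness_velocity ∧
      tao_finite_energy_velocity_uniqueness :=
  tao_unconditional_uniqueness_of_unit_leaves hL hP
    (tao2011_enstrophyLocalisation_exterior_apriori_unit_of_annulus hA)

end Literature.Analysis.FluidPDE

end
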